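import Literature.AlgebraicGeometry.Resolution.GiraudFunctionNormalForm
import Mathlib.AlgebraicGeometry.Morphisms.FiniteType
import HarnessLib

/-!
# Route `RadicialJung`, crux `CleanModels` (stmt-15917): the T2 target statement
# `Giraud24OverField` — Giraud's Thm. 2.4 for regular surfaces over an ARBITRARY field (OURS)

Route `ResolutionOfSingularities/RadicialJung`, crux item `CleanModels`
(stmt-ResolutionOfSingularities-15917), line `via-clean-models` of crux `DescentPerfectToAll`
(stmt-0549), PROGRAMME-clean-dim2 (W8.1), T2 architecture
(`HOME/L/res-L0-w81-pv-2/g5/T2-ARCHITECTURE.md`). Definitions file (reviewed). OURS: this is the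
statement OUR programme sets out to prove; it is NOT a statement of Hironaka's manuscript and NOT a
published theorem — J. Giraud, Bull. SMF 111 (1983), Thm. 2.4, proves it under his standing
hypothesis 1.1 "`Ω¹_X` localement libre de rang fini" (Frobenius finite and flat), typed in the tree
as the named fact `Literature.AlgebraicGeometry.Resolution.Giraud1983Thm24`; that hypothesis forces
the ground field to be `F`-finite, which EXCLUDES the fields over which the crux
`DescentPerfectToAll` lives (imperfect, not `F`-finite, e.g. of infinite `p`-rank). The T2 programme
re-proves Giraud's §§1–2 Ω-free (derivation form of `J(X, f, E)`,
`Literature/…/GiraudLogJacobianIdeal.lean`, `Theorems/RadicialJungCleanModelsLogContentIdeal*.lean`,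
`…GiraudTotalColength*.lean`) for regular surfaces LOCALLY OF FINITE TYPE OVER A FIELD, where
`Ω_{X/𝔽_p}` is still locally free (of infinite rank) on the regular locus
(`RadicialJungCleanModelsAbsoluteDifferentialsLocallyFree.lean`).

* `Giraud24OverField` — for every prime `p`, field `k` of characteristic `p`, integral quasi-compact
  regular `X` locally of finite type over `k` of dimension `2`, and global function `f` which is not
  a `p`-th power in `K(X)`: there is a proper `π : X′ → X` with `X′` integral and regular, an
  isomorphism over the complement of finitely many closed points, such that the pull-back of `f` is
  in Giraud's pointwise normal form of Prop. 1.5 (ii) (`Giraud15NormalFormAt`) at every CLOSED point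
  of `X′`. (Same rendering choices as `Giraud1983Thm24`; the conclusion is asked at closed points
  only, which is all the consumer `cleanModels_dimTwo_of_giraudOverField` uses — loose cleanness at
  closed points generises, `looseCleanAll_of_closedPoints`.)

Consumer: `Theorems/RadicialJungCleanModelsDimTwoCleanOverField.lean` —
`Giraud24OverField ⇒ CleanModels` for `dim W = 2` over every field (the hypothesis is taken there in
expanded form, exactly as c2's `Sketch` rev 10 files take `Giraud1983Thm24`).
-/

noncomputable section

set_option linter.dupNamespace false -- mandated namespace of this single-conjunct summit

open CategoryTheory AlgebraicGeometry TopologicalSpace IsLocalRing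
open Literature.AlgebraicGeometry.Resolution

namespace Summit.ResolutionOfSingularities.ResolutionOfSingularities.Theorems.RadicialJung.CleanModels

/-- **T2 target (OURS): Giraud's Thm. 2.4 with Prop. 1.5 (ii) for regular surfaces over an
arbitrary field.** For every prime `p`, every field `k` of characteristic `p`, every integral
quasi-compact scheme `X` locally of finite type over `k` which is regular of dimension `2`, and
every `f ∈ Γ(X, 𝒪_X)` which is not a `p`-th power in the function field: there are `X′` and a
proper `π : X′ → X` with `X′` integral and regular, `π` an isomorphism over the complement of
finitely many closed points of `X`, such that the germ of `π^* f` is in Giraud's normal form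
(`Giraud15NormalFormAt p`) at every closed point of `X′`. Replaces the role of the named fact
`Giraud1983Thm24` (Giraud, Bull. SMF 111 (1983), Thm. 2.4, which assumes `Ω¹_X` of finite rank)
for non-`F`-finite ground fields. A route-posited OPEN statement of OUR programme (to be PROVED by
the T2 bricks; not a published result; NOT a statement of Hironaka's manuscript). -/
def Giraud24OverField : Prop :=
  ∀ (p : ℕ) [Fact p.Prime] (k : Type) [Field k] [CharP k p] (X : Scheme.{0}) [IsIntegral X]
    [CompactSpace X] (q : X ⟶ Spec (.of k)) [LocallyOfFiniteType q],
    Scheme.IsRegular X → topologicalKrullDim X = 2 →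
    ∀ f : Γ(X, ⊤), (∀ c : X.functionField, c ^ p ≠ (X.presheaf.germ ⊤ (genericPoint X) trivial) f) →
    ∃ (X' : Scheme.{0}) (π : X' ⟶ X), IsProper π ∧ IsIntegral X' ∧ Scheme.IsRegular X' ∧
      (∃ U : X.Opens, ((U : Set X)ᶜ).Finite ∧ (∀ x ∈ (U : Set X)ᶜ, IsClosed ({x} : Set X)) ∧
        IsIso (π ∣_ U)) ∧
      ∀ x' : X', IsClosed ({x'} : Set X') →
        Giraud15NormalFormAt p ((X'.presheaf.germ ⊤ x' trivial) (π.appTop f))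

end Summit.ResolutionOfSingularities.ResolutionOfSingularities.Theorems.RadicialJung.CleanModels

end
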